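import Summits.Ventures.DiscreteObjects.Hadamard.ElemAbelianSummary668B
import Summits.Ventures.DiscreteObjects.Hadamard.ElemAbelianRank2_7

/-!
# Hadamard 668 census, family F12 — no `C_p × C_p` of signed automorphisms of an H(668) for every prime `p ≥ 7`
# (kernel summary)

Framing: lottery ticket; floor = certified bounds/negative ranges.

Cell pub-namedobj (venture DiscreteObjects), target (H), hadamard gen 17.  ONE QUOTABLE STATEMENT (supersedes the words
of `ElemAbelianSummary668B` by including `p = 7`): **`no_hadamard668_elemAbelian_rank2_ge7`** — for every prime
`p ≥ 7`, a Hadamard matrix of order `668` has no two signed-permutation automorphisms with `p`-th powers `1`, commuting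
permutation parts, and independent row parts (`⟨α, β⟩ ≅ C_p × C_p` on the rows): `p = 7` is
`no_hadamard668_elemAbelian_rank2_7` (gen 17: free row, regular-orbit bound, Burnside, cycle bound), `p = 11` is
`no_hadamard668_elemAbelian_rank2_11` (gen 16; short proof `no_hadamard668_elemAbelian_rank2_11'` in gen 17), `p ≥ 13`
is `no_hadamard668_elemAbelian_rank2` (Burnside against the fixed-structure census; orthogonality for `p = 23`).
WORDS: the signed automorphism group of any H(668) contains no elementary abelian subgroup of order `p²` for any prime
`p ≥ 7`; with `hadamard668_signedAut_not_dvd_orderOf_sq` (no `C_{p²}`, `p ≥ 11`) the Sylow `p`-subgroups for `p ≥ 11`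
are trivial or of order `p`, and (group theory, on paper: a `7`-group without `C₇ × C₇` is cyclic) the Sylow
`7`-subgroups are CYCLIC (order `7^k`; `k ≤ 2` would follow from excluding elements of order `343`, `k ≤ 1` from
excluding order `49` — both open here).  `C₃ × C₃`, `C₅ × C₅`: open (not excluded by these inequalities; cf. the
(+) control `C₃ × C₃ ≤ Aut H(12)`).  No automorphism or group is shown to EXIST; no order of the census table changes;
H(668) itself untouched.  Ours, not literature; no `sorry`.
-/

namespace Summit.Ventures.DiscreteObjects.Hadamard

open Finset BigOperators

open Literature.Combinatorics.Designs.GoethalsSeidel (IsHadamardMatrix)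

variable {ι : Type*} [Fintype ι] [DecidableEq ι]

/-- **No rank-2 elementary abelian `p`-subgroup `C_p × C_p` of signed automorphisms of an H(668), for any prime
`p ≥ 7`.** -/
theorem no_hadamard668_elemAbelian_rank2_ge7 {H : Matrix ι ι ℤ} (hH : IsHadamardMatrix H)
    (hι : Fintype.card ι = 668) (p : ℕ) (hp : p.Prime) (hp7 : 7 ≤ p)
    {α α' β β' : Equiv.Perm ι} {d₁ e₁ d₂ e₂ : ι → ℤ}
    (hA : IsSignedAut H α α' d₁ e₁) (hB : IsSignedAut H β β' d₂ e₂)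
    (hα : α ^ p = 1) (hα' : α' ^ p = 1) (hβ : β ^ p = 1) (hβ' : β' ^ p = 1)
    (hc : Commute α β) (hc' : Commute α' β')
    (hind : ∀ a b : ℕ, a < p → b < p → α ^ a * β ^ b = 1 → a = 0 ∧ b = 0) : False := by
  by_cases h7 : p = 7
  · subst h7
    exact no_hadamard668_elemAbelian_rank2_7 hH hι hA hB hα hα' hβ hβ' hc hc' hind
  · have hp11 : 11 ≤ p := by
      rcases Nat.lt_or_ge p 11 with h | h
      · interval_cases p
        · exact absurd rfl h7
        · exact absurd hp (by norm_num)
        · exact absurd hp (by norm_num)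
        · exact absurd hp (by norm_num)
      · exact h
    exact no_hadamard668_elemAbelian_rank2_ge11 hH hι p hp hp11 hA hB hα hα' hβ hβ' hc hc' hind

/-- **The elementary-abelian part of the census for all primes `p ≥ 7` together with the prime-square exclusions
(packaging).**  (1) no `C_p × C_p` for any prime `p ≥ 7`; (2) no element whose permutation pair has order divisible by
`p²` for `p ∈ {11, 13, 23, 37, 41, 83, 167}`. -/
theorem hadamard668_sylow_ge7_summary {H : Matrix ι ι ℤ} (hH : IsHadamardMatrix H) (hι : Fintype.card ι = 668) :
    (∀ (p : ℕ), p.Prime → 7 ≤ p → ∀ {α α' β β' : Equiv.Perm ι} {d₁ e₁ d₂ e₂ : ι → ℤ},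
      IsSignedAut H α α' d₁ e₁ → IsSignedAut H β β' d₂ e₂ → α ^ p = 1 → α' ^ p = 1 → β ^ p = 1 → β' ^ p = 1 →
      Commute α β → Commute α' β' → (∀ a b : ℕ, a < p → b < p → α ^ a * β ^ b = 1 → a = 0 ∧ b = 0) → False) ∧
    (∀ (p : ℕ), (p = 11 ∨ p = 13 ∨ p = 23 ∨ p = 37 ∨ p = 41 ∨ p = 83 ∨ p = 167) →
      ∀ {π κ : Equiv.Perm ι} {d e : ι → ℤ},
      IsSignedAut H π κ d e → ¬ p * p ∣ orderOf ((π, κ) : Equiv.Perm ι × Equiv.Perm ι)) := by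
  refine ⟨?_, (hadamard668_sylow_ge11_summary hH hι).2⟩
  intro p hp hp7 α α' β β' d₁ e₁ d₂ e₂ hA hB hα hα' hβ hβ' hc hc' hind
  exact no_hadamard668_elemAbelian_rank2_ge7 hH hι p hp hp7 hA hB hα hα' hβ hβ' hc hc' hind

end Summit.Ventures.DiscreteObjects.Hadamard
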